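import Literature.NumberTheory.Sieve.ChenTwinSieveLower
import Literature.NumberTheory.Sieve.RosserSieveTheoremOneHalfLt
import Literature.NumberTheory.Sieve.LinearSieveConstant
import Literature.NumberTheory.Sieve.SieveFunctionsBridge
import Literature.NumberTheory.Sieve.JurkatRichertRefutation
import Literature.NumberTheory.Sieve.ParityBarrierLevelProofs
import HarnessLib

/-!
# Chen's theorem, twin form: the sieve estimate (A) PROVED (`twin_sieveLower_holds`)

Topic `Literature/NumberTheory/Sieve`; companion ("Holds") file of `ChenTwin.lean` (the named fact
`Literature.NumberTheory.Sieve.Chen.twin_sieveLower`, DAG node (A) of the decomposition of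
`Literature.NumberTheory.Sieve.chen_twin`) and of `ChenTwinSieveLower.lean` (the conditional proof
`twin_sieveLower_of : LinearSieve.jurkatRichert_lower → BombieriVinogradovStatement → twin_sieveLower`
and the twin instance of the linear sieve: `twinSeq`, `sifted_twinSeq_eq`, `densityProduct_twinSeq_eq`,
`abs_remainder_twinSeq_le`, `eventually_sum_abs_primeCountingDisc_le`, …).

The fact is the twin-form analogue (Chen, Sci. Sinica 16 (1973), p. 176: "by the same method") of
Nathanson, *Additive Number Theory: The Classical Bases* (GTM 164), Theorem 10.4 (PDF pp. 171–172 of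
the held copy): for every `ε > 0` and all large `x`,

  `S(𝒜(x), x^{1/8}) ≥ (e^γ log 3 / 2 − ε) · (x / log x) · V(x^{1/8})`,

`𝒜(x) = {p + 2 : 2 < p ≤ x}`, `V(w) = ∏_{2<p<w} (1 − 1/(p−1))`. This file PROVES it UNCONDITIONALLY:
`Literature.NumberTheory.Sieve.Chen.twin_sieveLower_holds : twin_sieveLower`.

## The printed proof (Nathanson pp. 171–172) and the proof given here

Nathanson: (1) `|A| = π(N) + O(log N) = (N/log N)(1 + O(1/log N))` (prime number theorem);
(2) `r(d) = δ(N; d, N) + O(log N)` and `R = ∑_{d < QD, d ∣ P(z)} |r(d)| ≪ N/(log N)³` by the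
Bombieri–Vinogradov theorem with `D = N^{1/2}(log N)^{−B(3)−1} ≥ z²`; (3) the Jurkat–Richert lower
bound (Thm 9.7 (9.36)) with `z = N^{1/8}`, `s = log D/log z ∈ [3, 4]`,
`f(s) = 2e^γ log(s − 1)/s = e^γ log 3/2 + O(ε)` (Thm 9.8); (4) combine.

Here step (3) uses, instead of Nathanson's explicit form of the Jurkat–Richert theorem (the tree's
named fact `LinearSieve.jurkatRichert_lower`, not proved), the linear case `κ = 1` of **Iwaniec's
Rosser-sieve Theorem 1** in its uniform `y`-form, PROVED in the tree
(`Literature.NumberTheory.Sieve.Iwaniec1980_thm1_lower_of_half_lt`, `RosserSieveTheoremOneHalfLt.lean`):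
for greatest `β`-sieve data `(F, f, β, A)` of dimension `1` and every `L` there is `C = C(L)` with
`S(𝒜, z; x) ≥ X V(z) (f(s) − C (log y)^{−1/3}) − ∑_{d < y, d ∣ P(z)} |R_d(x)|`, `s = log y/log z`, for
every sifted sequence of dimension `Ω(1, L)`; the identification `f(s) = 2e^γ log(s − 1)/s` on `[2, 4]`
is the tree's `lowerSieveFun_one_eq_holds` (`LinearSieveConstant.lean`) transported along
`lowerSieveFun_one` (`SieveFunctionsBridge.lean`) and `IsGreatestBetaSieveData.eqOn_iwaniecSieveFun`.
This is the same theorem (Jurkat–Richert 1965 = Iwaniec 1980, `κ = 1`; Nathanson's Ch. 9 follows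
Iwaniec's notes, p. 165), with the error `εe^{14−s}` replaced by `C(log y)^{−1/3}` and hypothesis (9.34)
by `Ω(1, L)`. Step (2) uses the Bombieri–Vinogradov theorem PROVED in the tree
(`Literature.NumberTheory.Sieve.BombieriVinogradovStatement_holds`, `ParityBarrierLevelProofs.lean`:
Vaughan's identity, the large sieve, Siegel–Walfisz), in the `π`-form
`eventually_sum_abs_primeCountingDisc_le` of `ChenTwinSieveLower.lean`; step (1) the prime number
theorem (`eventually_primeCounting_bounds`). Parameters: `z = x^{1/8}`, `y = x^{1/2 − δ}`,
`s = 4 − 8δ`, `δ = δ(ε) → 0`.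

## Contents (all PROVED)

* `hasIwaniecDimension_shiftedPrimesDensity_two`: the density `g(d) = 1/φ(d)` (odd `d`), `0` (even
  `d`) of the twin problem satisfies Iwaniec's `Ω(1, L)` with `L = 54 e^{54/log 2}`
  (`(1 − 1/(p−1))⁻¹ = (1 − 1/p)⁻¹ (1 + 1/(p(p−2)))`, Mertens' product theorem with rate
  `PairProducts.abs_log_mertensProd_sub_le`, and `∏_{u ≤ p} (1 + 1/(p(p−2))) ≤ e^{2/(u−2)}`).
* Book-keeping for the sifting range `P(z) = ∏_{p<z} p` of Iwaniec's theorem (which contains the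
  non-sifting prime `2`, where `g(2) = 0`): `sifted_twinSeq_primesProdBelow`,
  `densityProduct_twinSeq_primesProdBelow`, `remainder_twinSeq_of_even`, `iwaniecRemainderSum_twinSeq_le`.
* `twin_sieveLower_holds`.

## References

* M. B. Nathanson, *Additive Number Theory: The Classical Bases*, GTM 164 (1996), Thm 10.4 and its
  proof (PDF pp. 171–172). [Nathanson1996]
* Chen Jing-run, Sci. Sinica 16 (1973), 157–176, p. 176 (= Wang Yuan (ed.), *Goldbach Conjecture*,
  p. 168): Theorem II "by the same method". [ChenSciSinica1973]
* H. Iwaniec, *Rosser's sieve*, Acta Arith. 36 (1980), 171–202, Theorem 1. [IwaniecActaArith1980]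
* E. Bombieri, *On the large sieve*, Mathematika 12 (1965), 201–225, Theorem 4. [Bombieri1965]
* G. H. Hardy, E. M. Wright, *An Introduction to the Theory of Numbers*, Thm 429 (Mertens).
  [HardyWright2008]
-/

open Finset Filter Topology

noncomputable section

namespace Literature.NumberTheory.Sieve.Chen

open LinearSieve ChenSieve SieveSequence

/-! ### The density of the twin problem has dimension `Ω(1, L)` -/

/-- `g(2) = 0`: the prime `2` does not sift (`(2, 2) ≠ 1`). [folklore] -/
theorem shiftedPrimesDensity_two_two : shiftedPrimesDensity 2 2 = 0 := by
  rw [shiftedPrimesDensity_apply, if_neg]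
  exact fun h => absurd h.1 (by decide)

/-- `g(d) = 0` for even `d`. [folklore] -/
theorem shiftedPrimesDensity_two_of_even {d : ℕ} (hd : Even d) : shiftedPrimesDensity 2 d = 0 := by
  rw [shiftedPrimesDensity_apply, if_neg]
  exact fun h => (Nat.not_odd_iff_even.mpr hd) (Nat.coprime_two_right.mp h.1)

/-- `0 ≤ g(p) < 1` at every prime. [folklore] -/
theorem shiftedPrimesDensity_two_prime_mem_Ico {p : ℕ} (hp : p.Prime) :
    0 ≤ shiftedPrimesDensity 2 p ∧ shiftedPrimesDensity 2 p < 1 := by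
  by_cases hp2 : p = 2
  · subst hp2
    rw [shiftedPrimesDensity_two_two]
    norm_num
  · rw [shiftedPrimesDensity_two_prime hp hp2]
    have h3 : (3 : ℝ) ≤ p := by exact_mod_cast lt_of_le_of_ne hp.two_le (Ne.symm hp2)
    constructor
    · exact div_nonneg zero_le_one (by linarith)
    · rw [div_lt_one (by linarith)]; linarith

/-- Termwise comparison with the Mertens factor: for every prime `p`,
`(1 − g(p))⁻¹ ≤ (1 − 1/p)⁻¹ (1 + 1/(p(p−2)))` (equality for odd `p`; for `p = 2` the left side is `1`,
and `1/(2·0) = 0` by convention). [folklore] -/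
theorem inv_one_sub_shiftedPrimesDensity_two_le {p : ℕ} (hp : p.Prime) :
    (1 - shiftedPrimesDensity 2 p)⁻¹ ≤ (1 - (p : ℝ)⁻¹)⁻¹ * (1 + 1 / ((p : ℝ) * ((p : ℝ) - 2))) := by
  by_cases hp2 : p = 2
  · subst hp2
    rw [shiftedPrimesDensity_two_two]
    norm_num
  · rw [shiftedPrimesDensity_two_prime hp hp2]
    have h3 : (3 : ℝ) ≤ p := by exact_mod_cast lt_of_le_of_ne hp.two_le (Ne.symm hp2)
    have h0 : (p : ℝ) ≠ 0 := by positivity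
    have h1 : (p : ℝ) - 1 ≠ 0 := by linarith
    have h2 : (p : ℝ) - 2 ≠ 0 := by linarith
    apply le_of_eq
    rw [show 1 - 1 / ((p : ℝ) - 1) = ((p : ℝ) - 2) / ((p : ℝ) - 1) by field_simp; ring,
      show 1 - (p : ℝ)⁻¹ = ((p : ℝ) - 1) / p by field_simp,
      show 1 + 1 / ((p : ℝ) * ((p : ℝ) - 2)) = ((p : ℝ) - 1) ^ 2 / ((p : ℝ) * ((p : ℝ) - 2)) by
        field_simp; ring,
      inv_div, inv_div, div_mul_div_comm, div_eq_div_iff h2 (by positivity)]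
    ring

/-- The correction product over a window of primes: `∏_{w ≤ p < z} (1 + 1/(p(p−2))) ≤ e^{4/log w}`
for `2 ≤ w` (from `prod_one_add_inv_mul_sub_two_le` at `u = max(w, 3)`: `2/(u − 2) ≤ 4/log w`; the
prime `2` contributes the factor `1`). [folklore] -/
theorem prod_window_one_add_inv_mul_sub_two_le {w z : ℝ} (hw : 2 ≤ w) :
    ∏ p ∈ (Nat.primesBelow ⌈z⌉₊).filter (fun p : ℕ => w ≤ (p : ℝ)), (1 + 1 / ((p : ℝ) * ((p : ℝ) - 2))) ≤
      Real.exp (4 / Real.log w) := by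
  set u := max w 3 with hu
  have hu3 : 3 ≤ u := le_max_right _ _
  have hwu : w ≤ u := le_max_left _ _
  have hlogw : 0 < Real.log w := Real.log_pos (by linarith)
  -- remove the prime `2` (factor `1`) and the primes between `w` and `u`... there are none except `2`
  have hsub : (Nat.primesBelow ⌈z⌉₊).filter (fun p : ℕ => u ≤ (p : ℝ)) ⊆
      (Nat.primesBelow ⌈z⌉₊).filter (fun p : ℕ => w ≤ (p : ℝ)) := by
    intro p hp
    rw [Finset.mem_filter] at hp ⊢
    exact ⟨hp.1, hwu.trans hp.2⟩
  have heq : ∏ p ∈ (Nat.primesBelow ⌈z⌉₊).filter (fun p : ℕ => w ≤ (p : ℝ)),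
      (1 + 1 / ((p : ℝ) * ((p : ℝ) - 2))) =
        ∏ p ∈ (Nat.primesBelow ⌈z⌉₊).filter (fun p : ℕ => u ≤ (p : ℝ)),
          (1 + 1 / ((p : ℝ) * ((p : ℝ) - 2))) := by
    refine (Finset.prod_subset hsub fun p hp hpu => ?_).symm
    rw [Finset.mem_filter] at hp hpu
    have hprime : p.Prime := Nat.prime_of_mem_primesBelow hp.1
    have hp3 : ¬ (3 : ℝ) ≤ p := fun h3 => hpu ⟨hp.1, max_le hp.2 h3⟩
    have hp2 : p = 2 := by
      have h2 := hprime.two_le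
      have : (p : ℝ) < 3 := not_le.mp hp3
      have : p < 3 := by exact_mod_cast this
      omega
    subst hp2
    norm_num
  rw [heq]
  refine (prod_one_add_inv_mul_sub_two_le (z := z) hu3).trans ?_
  rw [Real.exp_le_exp, div_le_div_iff₀ (by linarith) hlogw]
  -- `2 log w ≤ 4 (u - 2)`
  have hlw : Real.log w ≤ w - 1 := Real.log_le_sub_one_of_pos (by linarith)
  rcases le_or_gt 3 w with h3 | h3
  · have : u = w := max_eq_left h3
    rw [this]
    nlinarith
  · have : u = 3 := max_eq_right h3.le
    rw [this]
    nlinarith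

/-- **The twin density has Iwaniec dimension `Ω(1, L)`**, `L = 54 e^{54/log 2}`: for
`g(p) = 1/(p − 1)` (`p` odd), `g(2) = 0` and all `2 ≤ w ≤ z`,
`∏_{w ≤ p < z} (1 − g(p))⁻¹ ≤ (Π(z)/Π(w)) · ∏_{w ≤ p < z} (1 + 1/(p(p−2))) ≤ (log z/log w) e^{50/log w}
· e^{4/log w} ≤ (log z/log w)(1 + L/log w)` (Mertens' product theorem with rate,
`PairProducts.abs_log_mertensProd_sub_le`; Nathanson verifies the weaker (9.34) on pp. 169–170).
[cite: HardyWright2008, Thm 429 (§22.8)] -/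
theorem hasIwaniecDimension_shiftedPrimesDensity_two :
    HasIwaniecDimension (shiftedPrimesDensity 2) 1 (54 * Real.exp (54 / Real.log 2)) := by
  refine ⟨fun p hp => shiftedPrimesDensity_two_prime_mem_Ico hp, fun w z hw hwz => ?_⟩
  set S := (Nat.primesBelow ⌈z⌉₊).filter (fun p : ℕ => w ≤ (p : ℝ)) with hS
  have hlogw : 0 < Real.log w := Real.log_pos (by linarith)
  have hlogz : 0 < Real.log z := Real.log_pos (by linarith)
  have hlog2w : Real.log 2 ≤ Real.log w := Real.log_le_log two_pos hw
  have hlog2 : 0 < Real.log 2 := Real.log_pos one_lt_two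
  have hnonneg : ∀ p ∈ S, 0 ≤ (1 - shiftedPrimesDensity 2 p)⁻¹ := fun p hp =>
    inv_nonneg.mpr (sub_nonneg.mpr (shiftedPrimesDensity_two_prime_mem_Ico
      (Nat.prime_of_mem_primesBelow (Finset.mem_filter.mp hp).1)).2.le)
  have hpt : ∀ p ∈ S, (1 - shiftedPrimesDensity 2 p)⁻¹ ≤
      (1 - (p : ℝ)⁻¹)⁻¹ * (1 + 1 / ((p : ℝ) * ((p : ℝ) - 2))) := fun p hp =>
    inv_one_sub_shiftedPrimesDensity_two_le (Nat.prime_of_mem_primesBelow (Finset.mem_filter.mp hp).1)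
  -- the product is at most `(Π(z)/Π(w)) · ∏ (1 + 1/(p(p-2)))`
  set R := PairProducts.mertensProd z / PairProducts.mertensProd w with hR
  set W := ∏ p ∈ S, (1 + 1 / ((p : ℝ) * ((p : ℝ) - 2))) with hW
  have hRpos : 0 < R := div_pos (PairProducts.mertensProd_pos z) (PairProducts.mertensProd_pos w)
  have hW1 : ∀ p ∈ S, (1 : ℝ) ≤ 1 + 1 / ((p : ℝ) * ((p : ℝ) - 2)) := fun p hp => by
    have h2 : (2 : ℝ) ≤ p := by
      exact_mod_cast (Nat.prime_of_mem_primesBelow (Finset.mem_filter.mp hp).1).two_le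
    have : 0 ≤ 1 / ((p : ℝ) * ((p : ℝ) - 2)) := div_nonneg zero_le_one (by nlinarith)
    linarith
  have hW0 : 0 ≤ W := Finset.prod_nonneg fun p hp => zero_le_one.trans (hW1 p hp)
  have hprod : ∏ p ∈ S, (1 - shiftedPrimesDensity 2 p)⁻¹ ≤ R * W := by
    calc ∏ p ∈ S, (1 - shiftedPrimesDensity 2 p)⁻¹
        ≤ ∏ p ∈ S, ((1 - (p : ℝ)⁻¹)⁻¹ * (1 + 1 / ((p : ℝ) * ((p : ℝ) - 2)))) :=
          Finset.prod_le_prod hnonneg hpt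
      _ = R * W := by
          rw [Finset.prod_mul_distrib, hR, hW, hS, PairProducts.prod_filter_eq_mertensProd_div hwz]
  -- Mertens with rate: `R ≤ (log z / log w) e^{50/log w}`
  obtain ⟨-, hz2⟩ := abs_le.mp (PairProducts.abs_log_mertensProd_sub_le (le_trans hw hwz))
  obtain ⟨hw1, -⟩ := abs_le.mp (PairProducts.abs_log_mertensProd_sub_le hw)
  have hlogR : Real.log R ≤ Real.log (Real.log z) - Real.log (Real.log w) + 50 / Real.log w := by
    rw [hR, Real.log_div (PairProducts.mertensProd_pos z).ne' (PairProducts.mertensProd_pos w).ne']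
    have : 25 / Real.log z ≤ 25 / Real.log w :=
      div_le_div_of_nonneg_left (by norm_num) hlogw (Real.log_le_log (by linarith) hwz)
    have e50 : (50 : ℝ) / Real.log w = 2 * (25 / Real.log w) := by ring
    linarith
  have hR1 : R ≤ Real.log z / Real.log w * Real.exp (50 / Real.log w) := by
    have e1 : R = Real.exp (Real.log R) := (Real.exp_log hRpos).symm
    have e2 : Real.log z / Real.log w * Real.exp (50 / Real.log w) =
        Real.exp (Real.log (Real.log z) - Real.log (Real.log w) + 50 / Real.log w) := by
      rw [Real.exp_add, Real.exp_sub, Real.exp_log hlogz, Real.exp_log hlogw]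
    rw [e1, e2, Real.exp_le_exp]
    exact hlogR
  -- the correction product: `W ≤ e^{4/log w}`
  have hW4 : W ≤ Real.exp (4 / Real.log w) := prod_window_one_add_inv_mul_sub_two_le hw
  set t := 54 / Real.log w with ht_def
  have ht0 : 0 ≤ t := by positivity
  have htle : t ≤ 54 / Real.log 2 := div_le_div_of_nonneg_left (by norm_num) hlog2 hlog2w
  have hratio : 0 ≤ Real.log z / Real.log w := by positivity
  rw [Real.rpow_one]
  calc ∏ p ∈ S, (1 - shiftedPrimesDensity 2 p)⁻¹ ≤ R * W := hprod
    _ ≤ (Real.log z / Real.log w * Real.exp (50 / Real.log w)) * Real.exp (4 / Real.log w) :=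
        mul_le_mul hR1 hW4 hW0 (by positivity)
    _ = Real.log z / Real.log w * Real.exp t := by
        rw [mul_assoc, ← Real.exp_add, ht_def]; congr 2; ring
    _ ≤ Real.log z / Real.log w * (1 + t * Real.exp (54 / Real.log 2)) := by
        gcongr
        calc Real.exp t ≤ 1 + t * Real.exp t := PairProducts.exp_le_one_add_mul_exp t
          _ ≤ 1 + t * Real.exp (54 / Real.log 2) := by gcongr
    _ = Real.log z / Real.log w * (1 + 54 * Real.exp (54 / Real.log 2) / Real.log w) := by
        rw [ht_def]; ring

/-- The twin sequence has dimension `Ω(1, L)` at every height `x` (its density does not depend on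
`x`). [folklore] -/
theorem hasIwaniecDimension_twinSeq (x : ℕ) :
    HasIwaniecDimension (twinSeq x).density 1 (54 * Real.exp (54 / Real.log 2)) :=
  hasIwaniecDimension_shiftedPrimesDensity_two

/-! ### The sifting range `P(z) = ∏_{p<z} p` of Iwaniec's theorem (the prime `2` included) -/

/-- For odd `n`: `(n, P(z)) = 1 ↔ (n, ∏_{2<p<z} p) = 1`. [folklore] -/
theorem coprime_primesProdBelow_iff_of_odd {z : ℝ} {n : ℕ} (hn : Odd n) :
    n.Coprime (primesProdBelow z) ↔ n.Coprime (oddPrimesProd z) := by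
  rw [primesProdBelow, oddPrimesProd, Nat.coprime_prod_right_iff, Nat.coprime_prod_right_iff]
  constructor
  · exact fun h p hp => h p (Finset.mem_filter.mp hp).1
  · intro h p hp
    by_cases hp2 : p = 2
    · subst hp2
      exact Nat.coprime_two_right.mpr hn
    · exact h p (Finset.mem_filter.mpr ⟨hp, hp2⟩)

/-- `S(A, P(z); x + 2) = S(A, ∏_{2<p<z} p; x + 2)` for the twin sequence (its weights live on odd
integers), `= #{n ∈ 𝒜(x) : no prime factor < z}`. [folklore] -/
theorem sifted_twinSeq_primesProdBelow (x : ℕ) (z : ℝ) :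
    (twinSeq x).sifted ((x + 2 : ℕ) : ℝ) (primesProdBelow z) = roughCount (twinSieveSet x) ⌈z⌉₊ := by
  classical
  rw [← sifted_twinSeq_eq x z]
  change ∑ n ∈ (Finset.Ioc 0 ⌊((x + 2 : ℕ) : ℝ)⌋₊).filter (fun n : ℕ => n.Coprime (primesProdBelow z)),
      twinWeight x n =
    ∑ n ∈ (Finset.Ioc 0 ⌊((x + 2 : ℕ) : ℝ)⌋₊).filter (fun n : ℕ => n.Coprime (oddPrimesProd z)),
      twinWeight x n
  rw [sum_twinWeight, sum_twinWeight, Finset.filter_filter, Finset.filter_filter]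
  congr 2
  ext n
  rw [Finset.mem_filter, Finset.mem_filter]
  constructor
  · rintro ⟨hI, hcop, hn⟩
    exact ⟨hI, (coprime_primesProdBelow_iff_of_odd (odd_of_mem_twinSieveSet hn).1).mp hcop, hn⟩
  · rintro ⟨hI, hcop, hn⟩
    exact ⟨hI, (coprime_primesProdBelow_iff_of_odd (odd_of_mem_twinSieveSet hn).1).mpr hcop, hn⟩

/-- `V(P(z)) = ∏_{p<z} (1 − g(p)) = ∏_{2<p<z} (1 − 1/(p−1)) = Literature.Chen.sieveProduct 2 z`
(the factor at `p = 2` is `1 − g(2) = 1`). [folklore] -/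
theorem densityProduct_twinSeq_primesProdBelow (x : ℕ) (z : ℝ) :
    (twinSeq x).densityProduct (primesProdBelow z) = sieveProduct 2 z := by
  rw [← densityProduct_twinSeq_eq x z, SieveSequence.densityProduct, SieveSequence.densityProduct,
    primeFactors_primesProdBelow, primeFactors_oddPrimesProd]
  refine (Finset.prod_filter_of_ne fun p _ hp1 hp2 => ?_).symm
  subst hp2
  apply hp1
  change 1 - shiftedPrimesDensity 2 2 = 1
  rw [shiftedPrimesDensity_two_two, sub_zero]

/-- `r(d) = 0` for even `d` (no element of `𝒜(x)` is even, and `g(d) = 0`). [folklore] -/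
theorem remainder_twinSeq_of_even {x d : ℕ} (hd : Even d) :
    (twinSeq x).remainder d ((x + 2 : ℕ) : ℝ) = 0 := by
  classical
  rw [SieveSequence.remainder, SieveSequence.congrSum]
  change ∑ n ∈ (Finset.Ioc 0 ⌊((x + 2 : ℕ) : ℝ)⌋₊).filter (d ∣ ·), twinWeight x n -
    shiftedPrimesDensity 2 d * _ = 0
  rw [shiftedPrimesDensity_two_of_even hd, zero_mul, sub_zero, sum_twinWeight, Nat.cast_eq_zero,
    Finset.card_eq_zero, Finset.filter_eq_empty_iff]
  intro n hn hmem
  rw [Finset.mem_filter] at hn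
  have hodd := (odd_of_mem_twinSieveSet hmem).1
  exact (Nat.not_even_iff_odd.mpr hodd) ((even_iff_two_dvd.mp hd).trans hn.2 |> even_iff_two_dvd.mpr)

/-- **Iwaniec's remainder sum for the twin sequence is dominated by the Bombieri–Vinogradov sum**:
for `y ≤ Y`, `∑_{d < y, d ∣ P(z)} |r(d)| ≤ ∑_{d ≤ Y} |π(x; d, −2) − π(x)/φ(d)| + Y`
(`r(1) = 0`, `r(d) = 0` for even `d`, `|r(d)| ≤ |δ(x; d, −2)| + 1` for odd `d ≥ 3`; Nathanson p. 172).
[cite: Nathanson1996, §10.4 (proof of Thm 10.4)] -/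
theorem iwaniecRemainderSum_twinSeq_le {x : ℕ} (hx : 2 ≤ x) (z : ℝ) {y Y : ℝ} (hyY : y ≤ Y)
    (hY : 0 ≤ Y) :
    ∑ d ∈ (Finset.range ⌈y⌉₊).filter (· ∣ primesProdBelow z),
        |(twinSeq x).remainder d ((x + 2 : ℕ) : ℝ)| ≤
      (∑ d ∈ Finset.Icc 1 ⌊Y⌋₊, |primeCountingDisc d (negTwoUnit d : ZMod d) x|) + Y := by
  have hsub : (Finset.range ⌈y⌉₊).filter (· ∣ primesProdBelow z) ⊆ Finset.Icc 1 ⌊Y⌋₊ := by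
    intro d hd
    rw [Finset.mem_filter, Finset.mem_range] at hd
    rw [Finset.mem_Icc]
    refine ⟨Nat.pos_of_dvd_of_pos hd.2 (Nat.pos_of_ne_zero (primesProdBelow_ne_zero z)),
      Nat.le_floor ?_⟩
    have : (d : ℝ) < y := Nat.lt_ceil.mp hd.1
    linarith
  calc ∑ d ∈ (Finset.range ⌈y⌉₊).filter (· ∣ primesProdBelow z),
        |(twinSeq x).remainder d ((x + 2 : ℕ) : ℝ)|
      ≤ ∑ d ∈ (Finset.range ⌈y⌉₊).filter (· ∣ primesProdBelow z),
          (|primeCountingDisc d (negTwoUnit d : ZMod d) x| + 1) := by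
        refine Finset.sum_le_sum fun d hd => ?_
        rcases Nat.even_or_odd d with hev | hodd
        · rw [remainder_twinSeq_of_even hev, abs_zero]
          positivity
        by_cases h1 : d = 1
        · subst h1
          rw [remainder_twinSeq_one hx, abs_zero]
          positivity
        · have hd3 : 3 ≤ d := by
            rcases hodd with ⟨k, rfl⟩
            omega
          exact abs_remainder_twinSeq_le hodd hd3
    _ ≤ ∑ d ∈ Finset.Icc 1 ⌊Y⌋₊, (|primeCountingDisc d (negTwoUnit d : ZMod d) x| + 1) :=
        Finset.sum_le_sum_of_subset_of_nonneg hsub fun d _ _ => by positivity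
    _ = (∑ d ∈ Finset.Icc 1 ⌊Y⌋₊, |primeCountingDisc d (negTwoUnit d : ZMod d) x|) + ⌊Y⌋₊ := by
        rw [Finset.sum_add_distrib, Finset.sum_const, Nat.card_Icc, Nat.add_sub_cancel, nsmul_eq_mul,
          mul_one]
    _ ≤ _ := by gcongr; exact Nat.floor_le hY

/-- The linear-sieve function of the lower bound: for greatest `β`-sieve data `B = (F, f, β, A)` of
dimension `1`, `f(s) = 2e^γ log(s − 1)/s` for `2 ≤ s ≤ 4` (the tree's `lowerSieveFun_one_eq_holds`,
Jurkat–Richert; Nathanson Thm 9.8). [cite: Nathanson1996, Thm 9.8] -/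
theorem greatestBetaSieveData_one_lower_eq {B : (ℝ → ℝ) × (ℝ → ℝ) × ℝ × ℝ}
    (hB : IsGreatestBetaSieveData 1 B) {s : ℝ} (h2 : 2 ≤ s) (h4 : s ≤ 4) :
    B.2.1 s = 2 * Real.exp Real.eulerMascheroniConstant * Real.log (s - 1) / s := by
  rw [hB.eqOn_iwaniecSieveFun.2.1 (show s ∈ Set.Ioi (0 : ℝ) from (by norm_num : (0 : ℝ) < 2).trans_le h2),
    ← lowerSieveFun_one]
  exact lowerSieveFun_one_eq_holds (s := s) (Set.mem_Icc.mpr ⟨h2, h4⟩)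

/-! ### Assembly: the estimate (A), unconditionally -/

set_option maxHeartbeats 800000 in
/-- **The sieve estimate (A) in the twin form, PROVED** (`Literature.NumberTheory.Sieve.Chen.twin_sieveLower`,
the analogue for `𝒜(x) = {p + 2 : 2 < p ≤ x}` of Nathanson, *Additive Number Theory*, Theorem 10.4,
asserted for `{p + h}` by Chen, Sci. Sinica 16 (1973), p. 176): for every `ε > 0` and all large `x`,
`S(𝒜(x), x^{1/8}) ≥ (e^γ log 3/2 − ε)(x/log x) V(x^{1/8})`. Proof as printed (Nathanson pp. 171–172)
with the Jurkat–Richert lower bound supplied by Iwaniec's Theorem 1 for `κ = 1`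
(`Iwaniec1980_thm1_lower_of_half_lt`, `f(s) = 2e^γ log(s−1)/s` on `[2, 4]`), the dimension hypothesis
`Ω(1, L)` by `hasIwaniecDimension_shiftedPrimesDensity_two`, the remainder by the Bombieri–Vinogradov
theorem (`BombieriVinogradovStatement_holds`, `π`-form, level `x^{1/2−δ}`), the size `|𝒜(x)| = π(x) − 1`
by the prime number theorem, and `V(x^{1/8}) ≫ 1/log x` (`twinMainTerm_ge`) to absorb the error terms;
parameters `z = x^{1/8}`, `y = x^{1/2−δ}`, `s = 4 − 8δ`, `δ = min(1/16, ε/(16e^γ))`.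
[cite: Nathanson1996, Thm 10.4 (for the sequence {p+2}: ChenSciSinica1973, p. 176)] -/
theorem twin_sieveLower_holds : twin_sieveLower := by
  intro ε hε
  set G := Real.exp Real.eulerMascheroniConstant with hG
  have hG1 : 1 ≤ G := Real.one_le_exp (by linarith [Real.one_half_lt_eulerMascheroniConstant])
  have hlog3 : 1 < Real.log 3 := by
    rw [Real.lt_log_iff_exp_lt (by norm_num)]
    exact Real.exp_one_lt_d9.trans (by norm_num)
  set a := G * Real.log 3 / 2 with ha
  have ha0 : 0 < a := by positivity
  -- trivial case `ε ≥ a`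
  rcases le_or_gt a ε with hεa | hεa
  · refine Eventually.of_forall fun x => ?_
    have h1 : (G * Real.log 3 / 2 - ε) * twinMainTerm x ≤ 0 :=
      mul_nonpos_of_nonpos_of_nonneg (by linarith) (twinMainTerm_nonneg x)
    exact h1.trans (Nat.cast_nonneg _)
  -- parameters
  set δ := min (1 / 16) (ε / (16 * G)) with hδ
  have hδ0 : 0 < δ := by positivity
  have hδ1 : δ ≤ 1 / 16 := min_le_left _ _
  have hδ2 : δ ≤ ε / (16 * G) := min_le_right _ _
  set η := ε / (16 * a) with hη
  have hη0 : 0 < η := by positivity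
  set θ₁ := 1 / 2 - δ with hθ₁
  have hθ₁lt : θ₁ < 1 / 2 := by rw [hθ₁]; linarith
  have hθ₁0 : 0 < θ₁ := by rw [hθ₁]; linarith
  set L₀ := 54 * Real.exp (54 / Real.log 2) with hL₀
  -- Iwaniec's Theorem 1 for `κ = 1`
  obtain ⟨B, hB, hBC⟩ := Iwaniec1980_thm1_lower_of_half_lt (κ := 1) (by norm_num)
  obtain ⟨C₁, hC₁⟩ := hBC L₀
  -- Bombieri–Vinogradov
  obtain ⟨C, hC⟩ := eventually_sum_abs_primeCountingDisc_le BombieriVinogradovStatement_holds hθ₁lt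
    (A := 4) (by norm_num)
  set c₀ := 16 * Real.exp (-7) with hc₀
  have hc₀0 : 0 < c₀ := by positivity
  -- eventualities
  have hE1 := eventually_primeCounting_bounds hη0
  have hE4 : ∀ᶠ x : ℕ in atTop, a ≤ ε / 6 * c₀ * x / Real.log x ^ 2 :=
    (tendsto_mul_natCast_div_log_sq_atTop (by positivity : 0 < ε / 6 * c₀)).eventually_ge_atTop a
  have hE5 : ∀ᶠ x : ℕ in atTop, 6 * max C 0 / (ε * c₀) + 1 ≤ Real.log x :=
    (Real.tendsto_log_atTop.comp tendsto_natCast_atTop_atTop).eventually_ge_atTop _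
  have hE6 : ∀ᶠ x : ℕ in atTop, Real.log (x : ℝ) ^ 2 ≤ ε * c₀ / 6 * (x : ℝ) ^ (1 - θ₁) := by
    have hlo := (isLittleO_log_rpow_rpow_atTop 2 (show (0 : ℝ) < 1 - θ₁ by rw [hθ₁]; linarith)).def
      (show 0 < ε * c₀ / 6 by positivity)
    filter_upwards [tendsto_natCast_atTop_atTop.eventually hlo, eventually_ge_atTop 1] with x hx hx1
    have hx0 : (0 : ℝ) ≤ x := Nat.cast_nonneg x
    rw [Real.norm_of_nonneg (by positivity), Real.norm_of_nonneg (Real.rpow_nonneg hx0 _)] at hx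
    have : Real.log (x : ℝ) ^ (2 : ℝ) = Real.log x ^ 2 := by
      rw [show (2 : ℝ) = ((2 : ℕ) : ℝ) by norm_num, Real.rpow_natCast]
    rwa [this] at hx
  -- Iwaniec's error term `C₁ (log y)^{-1/3} → 0`
  have hT : Tendsto (fun x : ℕ => max C₁ 0 * (θ₁ * Real.log (x : ℝ)) ^ (-(1 / 3 : ℝ))) atTop
      (𝓝 (max C₁ 0 * 0)) :=
    ((tendsto_rpow_neg_atTop (by norm_num : (0 : ℝ) < 1 / 3)).comp
      ((Real.tendsto_log_atTop.comp tendsto_natCast_atTop_atTop).const_mul_atTop hθ₁0)).const_mul _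
  rw [mul_zero] at hT
  have hE7 : ∀ᶠ x : ℕ in atTop, max C₁ 0 * (θ₁ * Real.log (x : ℝ)) ^ (-(1 / 3 : ℝ)) ≤ ε / 16 :=
    hT.eventually (ge_mem_nhds (by positivity : (0 : ℝ) < ε / 16))
  filter_upwards [eventually_ge_atTop 6561, hE1, hC, hE4, hE5, hE6, hE7]
    with x hx hPNT hBVx hj1 hj5 hj6 hj7
  -- basic facts about `x`
  have hx2 : 2 ≤ x := by omega
  have hx1 : (1 : ℝ) < x := by exact_mod_cast (show 1 < x by omega)
  have hx0 : (0 : ℝ) < x := by linarith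
  have hlog : 0 < Real.log x := Real.log_pos hx1
  have hlog1 : 1 ≤ Real.log x := by
    have : 0 ≤ 6 * max C 0 / (ε * c₀) := by positivity
    linarith
  -- the sieve parameters
  set z := (x : ℝ) ^ (1 / 8 : ℝ) with hz
  set y := (x : ℝ) ^ θ₁ with hy
  have hz2 : 2 ≤ z := by
    rw [hz, show (2 : ℝ) = ((2 : ℝ) ^ (8 : ℕ)) ^ (1 / 8 : ℝ) by
      rw [← Real.rpow_natCast, ← Real.rpow_mul (by norm_num)]; norm_num]
    exact Real.rpow_le_rpow (by norm_num) (by exact_mod_cast (show 256 ≤ x by omega)) (by norm_num)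
  have hlogz : Real.log z = 1 / 8 * Real.log x := by rw [hz, Real.log_rpow hx0]
  have hlogy : Real.log y = θ₁ * Real.log x := by rw [hy, Real.log_rpow hx0]
  have hs : Real.log y / Real.log z = 4 - 8 * δ := by
    rw [hlogz, hlogy, hθ₁]; field_simp; ring
  have hzy : z ≤ y := by
    rw [hz, hy]
    exact Real.rpow_le_rpow_of_exponent_le hx1.le (by rw [hθ₁]; linarith)
  have hy0 : 0 ≤ y := Real.rpow_nonneg hx0.le _
  -- names for the quantities
  set V := sieveProduct 2 z with hV
  set P := (Nat.primeCounting x : ℝ) - 1 with hP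
  set L := (x : ℝ) / Real.log x with hL
  set R := ∑ d ∈ (Finset.range ⌈y⌉₊).filter (· ∣ primesProdBelow z),
    |(twinSeq x).remainder d ((x + 2 : ℕ) : ℝ)| with hR
  set K := c₀ * x / Real.log x ^ 2 with hK
  have hVI : 0 ≤ V ∧ V ≤ 1 := sieveProduct_two_mem_Icc z
  have hP0 : 0 ≤ P := by
    have : 1 ≤ Nat.primeCounting x := by
      have := Nat.primesLE_card_eq_primeCounting x
      have h2 : 2 ∈ Nat.primesLE x := Nat.mem_primesLE.mpr ⟨hx2, Nat.prime_two⟩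
      have := Finset.card_pos.mpr ⟨2, h2⟩
      omega
    rw [hP]
    have : (1 : ℝ) ≤ Nat.primeCounting x := by exact_mod_cast this
    linarith
  have hL0 : 0 ≤ L := by positivity
  have hmainTerm : twinMainTerm x = L * V := by rw [twinMainTerm, hL, hV, hz]
  have hKM : K ≤ L * V := by
    rw [← hmainTerm, hK, hc₀]
    exact twinMainTerm_ge hx
  -- Iwaniec's theorem applied to the twin sequence at height `x + 2`
  have hsz : (twinSeq x).size ((x + 2 : ℕ) : ℝ) = P := rfl
  have hI := hC₁ (twinSeq x) (hasIwaniecDimension_twinSeq x) ((x + 2 : ℕ) : ℝ) y z hz2 hzy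
    (by rw [hsz]; exact hP0)
  rw [hsz, densityProduct_twinSeq_primesProdBelow, sifted_twinSeq_primesProdBelow, hs,
    greatestBetaSieveData_one_lower_eq hB (by linarith) (by linarith), ← hG, ← hV, ← hR] at hI
  change _ ≤ (roughCount (twinSieveSet x) (twinZ x) : ℝ) at hI
  -- (1) the coefficient: `f(s) - C₁ (log y)^{-1/3} ≥ a - ε/4`
  have hcoef := sieveLowerConst_ge hε hδ0 hδ1 hδ2 (εJ := 0) (by positivity)
  rw [← hG, ← ha, zero_mul, sub_zero] at hcoef
  have herrI : C₁ * Real.log y ^ (-(1 / 3 : ℝ)) ≤ ε / 16 := by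
    rw [hlogy]
    have h0 : 0 ≤ (θ₁ * Real.log x) ^ (-(1 / 3 : ℝ)) := Real.rpow_nonneg (by positivity) _
    exact (mul_le_mul_of_nonneg_right (le_max_left C₁ 0) h0).trans hj7
  have hfE : a - ε / 4 ≤ 2 * G * Real.log (4 - 8 * δ - 1) / (4 - 8 * δ) - C₁ * Real.log y ^ (-(1 / 3 : ℝ)) := by
    linarith
  -- (2) the main term: `(a - ε/4) V P ≥ (a - 5ε/16) L V - a`
  have hPNT' : (1 - η) * L - 1 ≤ P := by rw [hP]; linarith [hPNT.1]
  have ha' : 0 ≤ a - ε / 4 := by linarith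
  have hmain : (a - 5 * ε / 16) * (L * V) - a ≤ (a - ε / 4) * (V * P) := by
    have h1 : (a - ε / 4) * (V * ((1 - η) * L - 1)) ≤ (a - ε / 4) * (V * P) :=
      mul_le_mul_of_nonneg_left (mul_le_mul_of_nonneg_left hPNT' hVI.1) ha'
    have h2 : (a - ε / 4) * V ≤ a := by
      have h21 : (a - ε / 4) * V ≤ a * V := mul_le_mul_of_nonneg_right (by linarith) hVI.1
      have h22 : a * V ≤ a * 1 := mul_le_mul_of_nonneg_left hVI.2 ha0.le
      linarith
    have h3 : a * η = ε / 16 := by rw [hη]; field_simp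
    have h4 : (a - ε / 4) * η * (L * V) ≤ ε / 16 * (L * V) := by
      refine mul_le_mul_of_nonneg_right ?_ (mul_nonneg hL0 hVI.1)
      have : (a - ε / 4) * η = ε / 16 - ε * η / 4 := by rw [← h3]; ring
      have : 0 ≤ ε * η := mul_nonneg hε.le hη0.le
      linarith
    have hLV : 0 ≤ L * V := mul_nonneg hL0 hVI.1
    linarith
  -- (3) the remainder
  have hRle : R ≤ C * x / Real.log x ^ 4 + y := by
    rw [hR]
    refine (iwaniecRemainderSum_twinSeq_le hx2 z le_rfl hy0).trans ?_
    have h2 := hBVx negTwoUnit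
    rw [show (4 : ℝ) = ((4 : ℕ) : ℝ) by norm_num, Real.rpow_natCast] at h2
    exact add_le_add h2 le_rfl
  have hj5' : max C 0 * x / Real.log x ^ 4 ≤ ε / 6 * K := by
    have hM0 : 0 ≤ max C 0 := le_max_right _ _
    have hlog2 : 6 * max C 0 / (ε * c₀) ≤ Real.log x ^ 2 := by
      have h1 : 6 * max C 0 / (ε * c₀) ≤ Real.log x := by linarith
      have h2 : Real.log x ≤ Real.log x ^ 2 := by nlinarith
      exact h1.trans h2
    have hlog3 : 6 * max C 0 ≤ ε * c₀ * Real.log x ^ 2 := by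
      rw [div_le_iff₀ (by positivity)] at hlog2
      linarith
    rw [hK, show max C 0 * (x : ℝ) / Real.log x ^ 4 =
        (max C 0 / Real.log x ^ 2) * (x / Real.log x ^ 2) by
          rw [div_mul_div_comm, show Real.log (x : ℝ) ^ 2 * Real.log x ^ 2 = Real.log x ^ 4 by ring],
      show ε / 6 * (c₀ * x / Real.log x ^ 2) = (ε * c₀ / 6) * (x / Real.log x ^ 2) by ring]
    refine mul_le_mul_of_nonneg_right ?_ (by positivity)
    rw [div_le_iff₀ (by positivity)]
    linarith
  have hj6' : y ≤ ε / 6 * K := by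
    have hsplit : (x : ℝ) = (x : ℝ) ^ θ₁ * (x : ℝ) ^ (1 - θ₁) := by
      rw [← Real.rpow_add hx0]; norm_num
    rw [hy, hK, show ε / 6 * (c₀ * x / Real.log x ^ 2) = (ε * c₀ / 6 * x) / Real.log x ^ 2 by ring,
      le_div_iff₀ (by positivity)]
    calc (x : ℝ) ^ θ₁ * Real.log x ^ 2 ≤ (x : ℝ) ^ θ₁ * (ε * c₀ / 6 * (x : ℝ) ^ (1 - θ₁)) :=
          mul_le_mul_of_nonneg_left hj6 (Real.rpow_nonneg hx0.le _)
      _ = ε * c₀ / 6 * ((x : ℝ) ^ θ₁ * (x : ℝ) ^ (1 - θ₁)) := by ring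
      _ = ε * c₀ / 6 * x := by rw [← hsplit]
  have hCle : C * x / Real.log x ^ 4 ≤ max C 0 * x / Real.log x ^ 4 := by
    have : 0 ≤ (x : ℝ) / Real.log x ^ 4 := by positivity
    rw [mul_div_assoc, mul_div_assoc]
    exact mul_le_mul_of_nonneg_right (le_max_left _ _) this
  have hj1' : a ≤ ε / 6 * K := by
    rw [hK, show ε / 6 * (c₀ * x / Real.log x ^ 2) = ε / 6 * c₀ * x / Real.log x ^ 2 by ring]
    exact hj1
  -- (4) combine
  have hVP0 : 0 ≤ V * P := mul_nonneg hVI.1 hP0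
  have hstep : (a - ε / 4) * (V * P) - R ≤
      P * V * (2 * G * Real.log (4 - 8 * δ - 1) / (4 - 8 * δ) - C₁ * Real.log y ^ (-(1 / 3 : ℝ))) - R := by
    have := mul_le_mul_of_nonneg_right hfE hVP0
    nlinarith
  have hfinal : (a - ε) * (L * V) ≤ (a - ε / 4) * (V * P) - R := by
    have hεK : ε * K ≤ ε * (L * V) := mul_le_mul_of_nonneg_left hKM hε.le
    have hεLV : 0 ≤ ε * (L * V) := mul_nonneg hε.le (mul_nonneg hL0 hVI.1)
    have s1 : a + R ≤ ε / 2 * K := by linarith [hRle, hCle, hj5', hj6', hj1']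
    have s2 : ε / 2 * K ≤ ε / 2 * (L * V) := by linarith [hεK]
    linarith [hmain, s1, s2]
  rw [hmainTerm]
  linarith [hI]

end Literature.NumberTheory.Sieve.Chen
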